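import Summits.KontsevichZagierPeriods.Zeta5Search.WedgeDictionaryLevelDescentVFullDescent
import HarnessLib

/-!
# The K-module form of `Y` and the closed form of the combined weight (T3 descent, step L3a)

HONEST FRAMING: "systematic search; no irrationality claim unless certified".

`Y(b) = (d+1)·SE(b) − Π₂(b)·SE(b−e₂)` (`ldY`) is a finite combination `Σ_{μ=1}^{N} Cw(b;μ)·K_μ` of the kernel factors
`K_μ = ldKer b μ` (which see only `N` and `B = (b₃..b₆)`), with the COMBINED WEIGHT
`Cw(b;μ) = (d+1)·Ω̄(b;−μ) − Π₂(b)·Ω̄(b−e₂;−μ)` (`ldCw`).  This file proves the K-module form (`ldY_eq_sum`), the two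
weight step lemmas in `m` (`ldStepM`) and in `b₁` (`ldStep1up`), and the CLOSED FORM of `Cw` on rows with all `c_tj ≥ 0`
(`ldCw_closed`: `Cw(b;μ)·(b₂+μ) = −μ(N−b₁+1)·∏_B(c₂ⱼ+1)·Ω(b−e₂;−μ)` for `1 ≤ μ ≤ c₁₂+1` — the ghost term `μ = c₁₂+1`
included — and `Cw = 0` above `c₁₂+1` or when some `c_tj < 0`).  The ratio lemmas R1/R2 built on these are in
`WedgeDictionaryLevelDescentVFullCwRatio`.  Exact cross-checks: pub-zeta5 g9 `e7_kmodule.py` (KM 359/359, closed forms on 120 rows).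
-/

open Finset

namespace Summit.KontsevichZagierPeriods.Zeta5Search.WedgeDictionary

open Summit.KontsevichZagierPeriods.Zeta5Search.DualSeries

/-! ## Small tools -/

/-- `facQ z = 1` for `z ≤ 0`. -/
theorem facQ_nonpos {z : ℤ} (hz : z ≤ 0) : facQ z = 1 := by
  unfold facQ
  rw [show z.toNat = 0 by omega]
  simp

/-- `∏_{j∈B}(c₂ⱼ + 1)`. -/
def ldQ2 (b : ℕ → ℤ) : ℚ :=
  ((b 0 : ℚ) - b 2 - b 3 + 1) * ((b 0 : ℚ) - b 2 - b 4 + 1) * ((b 0 : ℚ) - b 2 - b 5 + 1) * ((b 0 : ℚ) - b 2 - b 6 + 1)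

/-- `Π₂ = (c₂₁+1)·∏_B(c₂ⱼ+1)`. -/
theorem mixedPi2_eq (b : ℕ → ℤ) : mixedPi2 b = ((b 0 : ℚ) - b 2 - b 1 + 1) * ldQ2 b := by
  simp only [mixedPi2, ldQ2, prod_insert, mem_insert, mem_singleton, prod_singleton, Nat.reduceEqDiff, or_self,
    not_false_eq_true]
  ring

/-- The combined weight `Cw(b;μ) = (d+1)·Ω̄(b;−μ) − Π₂(b)·Ω̄(b−e₂;−μ)`. -/
def ldCw (b : ℕ → ℤ) (μ : ℕ) : ℚ :=
  ((dOf b : ℚ) + 1) * ldEW b (-(μ : ℤ)) - mixedPi2 b * ldEW (lowerSlot b 2) (-(μ : ℤ))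

/-! ## The K-module form of `Y` -/

/-- Reindexing `m = −μ`. -/
theorem sum_Icc_neg (n : ℤ) (f : ℤ → ℚ) : ∑ m ∈ Icc (-n) (-1), f m = ∑ μ ∈ Icc 1 n.toNat, f (-(μ : ℤ)) := by
  refine sum_nbij' (fun m => (-m).toNat) (fun μ => -(μ : ℤ)) ?_ ?_ ?_ ?_ ?_
  · intro m hm; simp only [mem_Icc] at hm ⊢; omega
  · intro μ hμ; simp only [mem_Icc] at hμ ⊢; omega
  · intro m hm; simp only [mem_Icc] at hm; omega
  · intro μ hμ; simp only [mem_Icc] at hμ; omega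
  · intro m hm; simp only [mem_Icc] at hm; congr 1; omega

/-- `SE(b) = Σ_{μ=1}^{N} Ω̄(b;−μ)·K_μ`. -/
theorem ldSE_eq_sum (b : ℕ → ℤ) : ldSE b = ∑ μ ∈ Icc 1 (b 0).toNat, ldEW b (-(μ : ℤ)) * ldKer b μ := by
  unfold ldSE ldE
  rw [sum_Icc_neg]
  refine sum_congr rfl (fun μ _ => ?_)
  rw [neg_neg, Int.toNat_natCast]

/-- `ldKer` is unchanged by lowering slot 2. -/
theorem ldKer_lowerSlot2 (b : ℕ → ℤ) (μ : ℕ) : ldKer (lowerSlot b 2) μ = ldKer b μ := by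
  unfold lowerSlot; exact ldKer_low2 b μ

/-- `kernel5` is unchanged by raising slot 1. -/
theorem kernel5_bump0 (b : ℕ → ℤ) (x : ℕ) : kernel5 (bump b 0) x = kernel5 b x := by
  have h0 : bump b 0 0 = b 0 := bump0_of_ne b (by decide)
  have hj : ∀ j ∈ Icc 3 6, bump b 0 j = b j := fun j hj => bump0_of_ne b (by simp only [mem_Icc] at hj; omega)
  unfold kernel5
  rw [h0, prod_congr rfl (fun j hj' => by rw [hj j hj'])]

/-- `ldKer` is unchanged by raising slot 1. -/
theorem ldKer_bump0 (b : ℕ → ℤ) (μ : ℕ) : ldKer (bump b 0) μ = ldKer b μ := by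
  simp only [ldKer, kernel5_bump0, bump0_of_ne b (show (0 : ℕ) ≠ 1 by decide)]

/-- K-MODULE FORM: `Y(b) = Σ_{μ=1}^{N} Cw(b;μ)·K_μ`. -/
theorem ldY_eq_sum (b : ℕ → ℤ) : ldY b = ∑ μ ∈ Icc 1 (b 0).toNat, ldCw b μ * ldKer b μ := by
  unfold ldY
  rw [ldSE_eq_sum, ldSE_eq_sum]
  have h0 : lowerSlot b 2 0 = b 0 := by simp [lowerSlot]
  simp only [h0, ldKer_lowerSlot2, mul_sum, ← sum_sub_distrib, ldCw]
  exact sum_congr rfl (fun μ _ => by ring)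

/-! ## Two more step lemmas for the symmetric weight -/

/-- The slot values of `b + e₁`. -/
theorem bump0_vals (b : ℕ → ℤ) : bump b 0 0 = b 0 ∧ bump b 0 1 = b 1 + 1 ∧ bump b 0 2 = b 2 ∧ bump b 0 3 = b 3 ∧
    bump b 0 4 = b 4 ∧ bump b 0 5 = b 5 ∧ bump b 0 6 = b 6 ∧ bump b 0 7 = b 7 :=
  ⟨bump0_of_ne b (by decide), bump0_one b, bump0_of_ne b (by decide), bump0_of_ne b (by decide),
    bump0_of_ne b (by decide), bump0_of_ne b (by decide), bump0_of_ne b (by decide), bump0_of_ne b (by decide)⟩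

/-- `(b + e₁) − e₂ = (b − e₂) + e₁`. -/
theorem lowerSlot2_bump0_comm (b : ℕ → ℤ) : lowerSlot (bump b 0) 2 = bump (lowerSlot b 2) 0 := by
  funext i
  simp only [lowerSlot, bump, Nat.zero_add, Function.update_apply]
  split_ifs <;> first | rfl | omega

/-- Numerator step in `m`: `Num(b;m−1) = ∏_B(N−b_j−m+1)·Num(b;m)`. -/
theorem ldNum_pred (b : ℕ → ℤ) (m : ℤ) (h3 : 0 ≤ b 0 - b 3 - m) (h4 : 0 ≤ b 0 - b 4 - m)
    (h5 : 0 ≤ b 0 - b 5 - m) (h6 : 0 ≤ b 0 - b 6 - m) :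
    ldNum b (m - 1) = (((b 0 : ℚ) - b 3 - m + 1) * ((b 0 : ℚ) - b 4 - m + 1) * ((b 0 : ℚ) - b 5 - m + 1) *
      ((b 0 : ℚ) - b 6 - m + 1)) * ldNum b m := by
  have q3 := facQ_succ h3
  rw [show b 0 - b 3 - m + 1 = b 0 - b 3 - (m - 1) by ring] at q3
  have q4 := facQ_succ h4
  rw [show b 0 - b 4 - m + 1 = b 0 - b 4 - (m - 1) by ring] at q4
  have q5 := facQ_succ h5
  rw [show b 0 - b 5 - m + 1 = b 0 - b 5 - (m - 1) by ring] at q5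
  have q6 := facQ_succ h6
  rw [show b 0 - b 6 - m + 1 = b 0 - b 6 - (m - 1) by ring] at q6
  simp only [ldNum]
  rw [q3, q4, q5, q6]
  push_cast
  ring

/-- Denominator step in `m` (`m ≤ 0`): `Den(b;m−1)·(N+m−σ) = (b₁−m+1)(b₂−m+1)(b₇−m+1)(2N−ΣB−m+1)·Den(b;m)`. -/
theorem ldDen_pred (b : ℕ → ℤ) (m : ℤ) (hm : m ≤ 0) (h1 : 0 ≤ b 1 - m) (h2 : 0 ≤ b 2 - m) (h7 : 0 ≤ b 7 - m)
    (hS : 0 ≤ 2 * b 0 - sumB b - m) (hσ : 0 ≤ b 0 + (m - 1) - sigmaT b) :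
    ldDen b (m - 1) * ((b 0 : ℚ) + m - sigmaT b) =
      ((b 1 : ℚ) - m + 1) * ((b 2 : ℚ) - m + 1) * ((b 7 : ℚ) - m + 1) * (2 * (b 0 : ℚ) - sumB b - m + 1) *
        ldDen b m := by
  have p1 := facQ_succ h1
  rw [show b 1 - m + 1 = b 1 - (m - 1) by ring] at p1
  have p2 := facQ_succ h2
  rw [show b 2 - m + 1 = b 2 - (m - 1) by ring] at p2
  have p7 := facQ_succ h7
  rw [show b 7 - m + 1 = b 7 - (m - 1) by ring] at p7
  have pS := facQ_succ hS
  rw [show 2 * b 0 - sumB b - m + 1 = 2 * b 0 - sumB b - (m - 1) by ring] at pS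
  have pσ := facQ_succ hσ
  rw [show b 0 + (m - 1) - sigmaT b + 1 = b 0 + m - sigmaT b by ring] at pσ
  simp only [ldDen]
  rw [p1, p2, p7, pS, pσ, facQ_nonpos hm, facQ_nonpos (show m - 1 ≤ 0 by omega)]
  push_cast
  ring

/-- Step in `m` (downwards, `m ≤ 0`):
`(b₁−m+1)(b₂−m+1)(b₇−m+1)(2N−ΣB−m+1)·Ω(b;m−1) = −∏_B(N−b_j−m+1)·(N+m−σ)·Ω(b;m)`. -/
theorem ldStepM (b : ℕ → ℤ) (m : ℤ) (hm : m ≤ 0) (h1 : 0 ≤ b 1 - m) (h2 : 0 ≤ b 2 - m) (h7 : 0 ≤ b 7 - m)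
    (h3 : 0 ≤ b 0 - b 3 - m) (h4 : 0 ≤ b 0 - b 4 - m) (h5 : 0 ≤ b 0 - b 5 - m) (h6 : 0 ≤ b 0 - b 6 - m)
    (hS : 0 ≤ 2 * b 0 - sumB b - m) (hσ : 0 ≤ b 0 + (m - 1) - sigmaT b) :
    ((b 1 : ℚ) - m + 1) * ((b 2 : ℚ) - m + 1) * ((b 7 : ℚ) - m + 1) * (2 * (b 0 : ℚ) - sumB b - m + 1) *
        ldWeightSym b (m - 1) =
      -((((b 0 : ℚ) - b 3 - m + 1) * ((b 0 : ℚ) - b 4 - m + 1) * ((b 0 : ℚ) - b 5 - m + 1) *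
          ((b 0 : ℚ) - b 6 - m + 1)) * ((b 0 : ℚ) + m - sigmaT b)) * ldWeightSym b m := by
  have hs : (-1 : ℚ) ^ (m - 1 + sumB b) = -(-1 : ℚ) ^ (m + sumB b) := by
    rw [show m - 1 + sumB b = (m + sumB b) - 1 by ring, zpow_sub_one₀ (by norm_num : (-1 : ℚ) ≠ 0)]
    norm_num
  have hN := ldNum_pred b m h3 h4 h5 h6
  have hD := ldDen_pred b m hm h1 h2 h7 hS hσ
  rw [ldWeightSym_eq, ldWeightSym_eq, hs, hN, mul_div_assoc', mul_div_assoc',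
    div_eq_div_iff (ldDen_ne_zero _ _) (ldDen_ne_zero _ _)]
  generalize ((b 1 : ℚ) - m + 1) * ((b 2 : ℚ) - m + 1) * ((b 7 : ℚ) - m + 1) * (2 * (b 0 : ℚ) - sumB b - m + 1) = P
    at hD ⊢
  generalize ((b 0 : ℚ) - b 3 - m + 1) * ((b 0 : ℚ) - b 4 - m + 1) * ((b 0 : ℚ) - b 5 - m + 1) *
    ((b 0 : ℚ) - b 6 - m + 1) = Q
  linear_combination (2 * (-1 : ℚ) ^ (m + sumB b) * Q * ldNum b m) * hD

set_option maxHeartbeats 800000 in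
/-- Step in `b₁` (upwards): `d·(b₁−m+1)·Ω(b+e₁;m) = (b₁+1)·∏_B c₁ⱼ·(N+m−σ)·Ω(b;m)` (all `c₁ⱼ ≥ 1`, `d ≥ 1`, `N+m−σ ≥ 1`). -/
theorem ldStep1up (b : ℕ → ℤ) (m : ℤ) (hd : 1 ≤ dOf b) (hb1 : 0 ≤ b 1) (h1m : 0 ≤ b 1 - m)
    (h3 : 1 ≤ b 0 - b 1 - b 3) (h4 : 1 ≤ b 0 - b 1 - b 4) (h5 : 1 ≤ b 0 - b 1 - b 5) (h6 : 1 ≤ b 0 - b 1 - b 6)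
    (hσ : 1 ≤ b 0 + m - sigmaT b) :
    (dOf b : ℚ) * ((b 1 : ℚ) - m + 1) * ldWeightSym (bump b 0) m =
      ((b 1 : ℚ) + 1) * (((b 0 : ℚ) - b 1 - b 3) * ((b 0 : ℚ) - b 1 - b 4) * ((b 0 : ℚ) - b 1 - b 5) *
        ((b 0 : ℚ) - b 1 - b 6)) * ((b 0 : ℚ) + m - sigmaT b) * ldWeightSym b m := by
  obtain ⟨e0, e1, e2, e3, e4, e5, e6, e7⟩ := bump0_vals b
  have hsB : sumB (bump b 0) = sumB b := by simp only [sumB, e3, e4, e5, e6]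
  have hσB : sigmaT (bump b 0) = sigmaT b + 1 := by simp only [sigmaT, e1, e2, e7]; ring
  have hdB : dOf (bump b 0) = dOf b - 1 := dOf_bump b (by simp)
  rw [ldWeightSym_eq, ldWeightSym_eq, hsB, mul_div_assoc', mul_div_assoc',
    div_eq_div_iff (ldDen_ne_zero _ _) (ldDen_ne_zero _ _)]
  simp only [ldNum, ldDen, hdB, hsB, hσB, e0, e1, e2, e3, e4, e5, e6, e7]
  have pd := facQ_succ (z := dOf b - 1) (by omega)
  rw [show dOf b - 1 + 1 = dOf b by ring] at pd
  have pb := facQ_succ hb1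
  have p1 := facQ_succ h1m
  rw [show b 1 - m + 1 = b 1 + 1 - m by ring] at p1
  have q3 := facQ_succ (z := b 0 - (b 1 + 1) - b 3) (by omega)
  rw [show b 0 - (b 1 + 1) - b 3 + 1 = b 0 - b 1 - b 3 by ring] at q3
  have q4 := facQ_succ (z := b 0 - (b 1 + 1) - b 4) (by omega)
  rw [show b 0 - (b 1 + 1) - b 4 + 1 = b 0 - b 1 - b 4 by ring] at q4
  have q5 := facQ_succ (z := b 0 - (b 1 + 1) - b 5) (by omega)
  rw [show b 0 - (b 1 + 1) - b 5 + 1 = b 0 - b 1 - b 5 by ring] at q5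
  have q6 := facQ_succ (z := b 0 - (b 1 + 1) - b 6) (by omega)
  rw [show b 0 - (b 1 + 1) - b 6 + 1 = b 0 - b 1 - b 6 by ring] at q6
  have pσ := facQ_succ (z := b 0 + m - (sigmaT b + 1)) (by omega)
  rw [show b 0 + m - (sigmaT b + 1) + 1 = b 0 + m - sigmaT b by ring] at pσ
  rw [pd, pb, p1, q3, q4, q5, q6, pσ]
  push_cast
  ring

/-! ## Closed form, ghost term and vanishing of the combined weight -/

/-- Above the ghost index the combined weight vanishes: `Cw(b;μ) = 0` for `μ ≥ N − σ + 2`. -/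
theorem ldCw_eq_zero_of_le (a : ℕ → ℤ) (μ : ℕ) (h : a 0 - sigmaT a + 2 ≤ (μ : ℤ)) : ldCw a μ = 0 := by
  have s1 : ¬ ldESupp a (-(μ : ℤ)) := fun hs => by have := hs.2.2; omega
  have s2 : ¬ ldESupp (lowerSlot a 2) (-(μ : ℤ)) := fun hs => by
    have := hs.2.2
    simp only [sigmaT, lowerSlot, low2_0, low2_1, low2_2, low2_7] at this
    simp only [sigmaT] at h
    omega
  simp [ldCw, ldEW, s1, s2]

/-- Off the cone (`some c_tj < 0`) the combined weight vanishes identically (the lowered term, if present, meets a zero of `Π₂`). -/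
theorem ldCw_eq_zero_of_not_CC (a : ℕ → ℤ) (hC : ¬ (∀ t ∈ ({1, 2, 7} : Finset ℕ), ∀ j ∈ Icc 3 6, 0 ≤ a 0 - a t - a j)) (μ : ℕ) : ldCw a μ = 0 := by
  have s1 : ¬ ldESupp a (-(μ : ℤ)) := fun hs => hC hs.1
  by_cases s2 : ldESupp (lowerSlot a 2) (-(μ : ℤ))
  · have h2 := s2.1
    simp only [Icc_three_six, mem_insert, mem_singleton, forall_eq_or_imp, forall_eq, lowerSlot, low2_0,
      low2_1, low2_2, low2_3, low2_4, low2_5, low2_6, low2_7] at hC h2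
    have hz : a 0 - a 2 - a 3 + 1 = 0 ∨ a 0 - a 2 - a 4 + 1 = 0 ∨ a 0 - a 2 - a 5 + 1 = 0 ∨
        a 0 - a 2 - a 6 + 1 = 0 := by omega
    have hP : (a 0 - a 2 - a 3 + 1) * ((a 0 - a 2 - a 4 + 1) * ((a 0 - a 2 - a 5 + 1) * (a 0 - a 2 - a 6 + 1))) = 0 := by
      rcases hz with hz | hz | hz | hz <;> simp [hz]
    have hPq : ((a 0 : ℚ) - a 2 - a 3 + 1) * (((a 0 : ℚ) - a 2 - a 4 + 1) * (((a 0 : ℚ) - a 2 - a 5 + 1) *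
        ((a 0 : ℚ) - a 2 - a 6 + 1))) = 0 := by
      exact_mod_cast hP
    have hPi : mixedPi2 a = 0 := by
      rw [mixedPi2_eq, ldQ2]; linear_combination ((a 0 : ℚ) - a 2 - a 1 + 1) * hPq
    simp [ldCw, ldEW, s1, hPi]
  · simp [ldCw, ldEW, s1, s2]

set_option maxHeartbeats 800000 in
/-- CLOSED FORM on the cone, ghost term included: for `1 ≤ μ ≤ c₁₂ + 1`,
`Cw(b;μ)·(b₂+μ) = −μ(N−b₁+1)·∏_B(c₂ⱼ+1)·Ω(b−e₂;−μ)`. -/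
theorem ldCw_closed (a : ℕ → ℤ) (hbox : ∀ j ∈ Icc 1 7, 0 ≤ a j ∧ a j ≤ a 0)
    (hB : ∀ j ∈ Icc 3 6, 2 * a j ≤ a 0) (ha2 : 1 ≤ a 2) (ha7 : a 7 = 0) (hC : ∀ t ∈ ({1, 2, 7} : Finset ℕ), ∀ j ∈ Icc 3 6, 0 ≤ a 0 - a t - a j)
    (μ : ℕ) (hμ : 1 ≤ μ) (hμc : (μ : ℤ) ≤ a 0 - a 1 - a 2 + 1) :
    ldCw a μ * ((a 2 : ℚ) + μ) =
      -((μ : ℚ) * ((a 0 : ℚ) - a 1 + 1) * ldQ2 a * ldWeightSym (lowerSlot a 2) (-(μ : ℤ))) := by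
  have hd0 := layer_le_dOf a hB ha7
  simp only [mem_Icc] at hbox
  have hx1 := hbox 1 (by norm_num); have hx2 := hbox 2 (by norm_num)
  have hC' := hC
  simp only [Icc_three_six, mem_insert, mem_singleton, forall_eq_or_imp, forall_eq] at hC'
  have s2 : ldESupp (lowerSlot a 2) (-(μ : ℤ)) := by
    simp only [ldESupp, Icc_three_six, mem_insert, mem_singleton, forall_eq_or_imp, forall_eq, sigmaT, lowerSlot,
      low2_0, low2_1, low2_2, low2_3, low2_4, low2_5, low2_6, low2_7]
    omega
  rcases (show (μ : ℤ) ≤ a 0 - a 1 - a 2 ∨ (μ : ℤ) = a 0 - a 1 - a 2 + 1 by omega) with h | h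
  · have s1 : ldESupp a (-(μ : ℤ)) := by
      refine ⟨hC, by omega, ?_⟩
      simp only [sigmaT]; omega
    simp only [ldCw, ldEW, s1, s2, if_true, mixedPi2_eq]
    have st := ldStep2 a (-(μ : ℤ)) ha2 (by omega) (by omega) (by omega) (by omega) (by omega) (by omega) (by omega)
    unfold lowerSlot
    simp only [ldQ2]
    push_cast at st ⊢
    simp only [ha7, Int.cast_zero, add_zero] at st
    linear_combination (-1 : ℚ) * st
  · have s1 : ¬ ldESupp a (-(μ : ℤ)) := fun hs => by have := hs.2.2; simp only [sigmaT] at this; omega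
    simp only [ldCw, ldEW, s1, s2, if_false, if_true, mixedPi2_eq, mul_zero, zero_sub]
    have hq : (μ : ℚ) = (a 0 : ℚ) - a 1 - a 2 + 1 := by exact_mod_cast h
    linear_combination ((a 2 : ℚ) * ldQ2 a * ldWeightSym (lowerSlot a 2) (-(μ : ℤ))) * hq

/-- The combined weight vanishes at `μ = N + 1` (rows with `b₁, b₇ ≥ 0`, `b₂ ≥ 1`). -/
theorem ldCw_top (a : ℕ → ℤ) (h1 : 0 ≤ a 1) (h2 : 1 ≤ a 2) (h7 : 0 ≤ a 7) : ldCw a ((a 0).toNat + 1) = 0 := by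
  apply ldCw_eq_zero_of_le
  simp only [sigmaT]
  push_cast
  omega

/-- Documentation anchor (K-MODULE FORM, CLOSED FORM and the vanishing lemmas; module docstring). -/
def ldKModule_stmt : Prop :=
  (∀ b : ℕ → ℤ, ldY b = ∑ μ ∈ Icc 1 (b 0).toNat, ldCw b μ * ldKer b μ) ∧
    (∀ a : ℕ → ℤ, (∀ j ∈ Icc 1 7, 0 ≤ a j ∧ a j ≤ a 0) → (∀ j ∈ Icc 3 6, 2 * a j ≤ a 0) → 1 ≤ a 2 → a 7 = 0 →
      (∀ t ∈ ({1, 2, 7} : Finset ℕ), ∀ j ∈ Icc 3 6, 0 ≤ a 0 - a t - a j) → ∀ μ : ℕ, 1 ≤ μ →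
        (μ : ℤ) ≤ a 0 - a 1 - a 2 + 1 →
        ldCw a μ * ((a 2 : ℚ) + μ) =
          -((μ : ℚ) * ((a 0 : ℚ) - a 1 + 1) * ldQ2 a * ldWeightSym (lowerSlot a 2) (-(μ : ℤ)))) ∧
    (∀ a : ℕ → ℤ, ∀ μ : ℕ, a 0 - sigmaT a + 2 ≤ (μ : ℤ) → ldCw a μ = 0) ∧
    (∀ a : ℕ → ℤ, ¬ (∀ t ∈ ({1, 2, 7} : Finset ℕ), ∀ j ∈ Icc 3 6, 0 ≤ a 0 - a t - a j) → ∀ μ : ℕ, ldCw a μ = 0) ∧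
    (∀ a : ℕ → ℤ, 0 ≤ a 1 → 1 ≤ a 2 → 0 ≤ a 7 → ldCw a ((a 0).toNat + 1) = 0) ∧
    (∀ b : ℕ → ℤ, ∀ μ : ℕ, ldKer (bump b 0) μ = ldKer b μ) ∧
    (∀ b : ℕ → ℤ, lowerSlot (bump b 0) 2 = bump (lowerSlot b 2) 0)

/-- `ldKModule_stmt` holds. -/
theorem ldKModule_holds : ldKModule_stmt :=
  ⟨ldY_eq_sum, ldCw_closed, ldCw_eq_zero_of_le, ldCw_eq_zero_of_not_CC, ldCw_top, ldKer_bump0, lowerSlot2_bump0_comm⟩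

/-- Documentation anchor (the two weight steps W1, W2; module docstring). -/
def ldWeightSteps_stmt : Prop :=
  (∀ (b : ℕ → ℤ) (m : ℤ), m ≤ 0 → 0 ≤ b 1 - m → 0 ≤ b 2 - m → 0 ≤ b 7 - m → 0 ≤ b 0 - b 3 - m →
      0 ≤ b 0 - b 4 - m → 0 ≤ b 0 - b 5 - m → 0 ≤ b 0 - b 6 - m → 0 ≤ 2 * b 0 - sumB b - m →
      0 ≤ b 0 + (m - 1) - sigmaT b →
      ((b 1 : ℚ) - m + 1) * ((b 2 : ℚ) - m + 1) * ((b 7 : ℚ) - m + 1) * (2 * (b 0 : ℚ) - sumB b - m + 1) *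
          ldWeightSym b (m - 1) =
        -((((b 0 : ℚ) - b 3 - m + 1) * ((b 0 : ℚ) - b 4 - m + 1) * ((b 0 : ℚ) - b 5 - m + 1) *
            ((b 0 : ℚ) - b 6 - m + 1)) * ((b 0 : ℚ) + m - sigmaT b)) * ldWeightSym b m) ∧
    ∀ (b : ℕ → ℤ) (m : ℤ), 1 ≤ dOf b → 0 ≤ b 1 → 0 ≤ b 1 - m → 1 ≤ b 0 - b 1 - b 3 → 1 ≤ b 0 - b 1 - b 4 →
      1 ≤ b 0 - b 1 - b 5 → 1 ≤ b 0 - b 1 - b 6 → 1 ≤ b 0 + m - sigmaT b →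
      (dOf b : ℚ) * ((b 1 : ℚ) - m + 1) * ldWeightSym (bump b 0) m =
        ((b 1 : ℚ) + 1) * (((b 0 : ℚ) - b 1 - b 3) * ((b 0 : ℚ) - b 1 - b 4) * ((b 0 : ℚ) - b 1 - b 5) *
          ((b 0 : ℚ) - b 1 - b 6)) * ((b 0 : ℚ) + m - sigmaT b) * ldWeightSym b m

/-- `ldWeightSteps_stmt` holds. -/
theorem ldWeightSteps_holds : ldWeightSteps_stmt := ⟨ldStepM, ldStep1up⟩

end Summit.KontsevichZagierPeriods.Zeta5Search.WedgeDictionary
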